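import Summits.QuantumFields.BalabanUV.Beta.GAN24.SymRMChargeFreeFace

/-!
# `BalabanUV.Beta.GAN24.SymM1ChargeFree` — binder row G-an2-4 ∕ (CONV-C), CT-W route «WC-TL» ∕ (Q-R) «QR-LL», the (S) row of RULING R-gan24p1-g27-1, PART 5 (a free
# corollary of (S-β)'s machinery): **an1's (0.4)-SYMMETRISED MULTIPLIER LETTER `M1Of 3 Lc (symHessFFAt ρ_c Lc) cΛ j ρ′ w` IS CHARGE-FREE PER LETTER IN BOTH FLAT
# CURRENCIES — PLAIN (centred root, `Lc` odd) AND EXIT-FACE** — so in every `dM` ∕ `vertexOfM` read of the sym row's first-order letters (the (α), (γ), (W-γ)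
# value forms of p2 ∕ leaf-06 read on an1's sym tables) THE MULTIPLIER HALF `Σ_ρ′ Σ'_w colM G ν y′ ρ′ w · Z_M(ρ′,w)` DROPS: `Z_M ≡ 0`
# (G-an2-4 formalisation swarm → CRUX TEAM (2), seat `b2b-balaban-gan24-formalise-leaf-02`, gen 55)

NOT IN PRINT; OUR BOOKKEEPING ([folklore] finite-sum algebra over PARTs 1a∕1b (exactness, transverse block reflection), PART 2 (row sums, supports), PART 3b (exit-face
pairings), an1's `MultiplierTableSlot.M1Of` ∕ `SymAveragingHessianCounts.symHessFFAt` and p2's value forms BY NAME; 0 `def`, 0 cited fact, 0 `def … : Prop`, 0 sorry).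
HONEST FRAMING (cell contract, verbatim): «discharging `BetaPertH` makes Bałaban's UV stability UNCONDITIONAL — a real constructive-QFT result; it is NOT the continuum limit
and NOT the Clay problem.»  HONEST DEPENDENCY (verbatim): «continuum YM on T⁴ ⇐ BetaPertH ∧ nine spine estimates (0/9 proved); BetaPertH ⇐ (D1) ∧ (D4) ∧ CAP+tail; G-an2-4
gates asym, D1 and NE2/3/4.»

WHY.  The letter is `(cΛ·wM1 j) • symHessFFAt ρ_c Lc ρ′ w` (`M1Of_apply`); its field–field pair charge in channel `(β,β′)` is `(cΛ·wM1 j)·Σ_{x,x′} h((β,x),(β′,x′)) =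
(cΛ·wM1 j)·H(dφ_β, dφ_{β′})` — BOTH slots exact — so the second-slot `dψ`-law leaves `−½(cΛ·wM1 j)·Σ'_x W_{β′}(β,x)·q¹(β,x)`, which is `0` on the diagonal by PART 1a's
exactness and off the diagonal by PART 1b's transverse block reflection; with the exit-face weight both slots are again exact (coarse coordinates) and PART 3b §2 applies
with `U` constant, `V = 0`.  Numerics (exact rationals on the definitions, `g55/num/sym_m1_charge.py`): plain 0 (L = 3, 5 odd; NOT 0 at L = 4 — the centred root is used),
exit⊗exit 0 (every L), exit⊗plain 0 (odd L).
* §1 **`tsum_prod_symHessKerAt_eq_zero`** (`Σ'_{(x,x′)} h((β,x),(β′,x′)) = 0`), **`tsum_prod_symM1_inl_inl`**, `tsum_prod_symM1` (all fibre indices).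
* §2 **`tsum_prod_face_symM1_inl_inl`** (exit-face currency, every `cΛ`).
* §3 **`hasSum_prod_vertexOfM_symM1`** ∕ **`hasSum_face_vertexOfM_symM1`** — through ANY `G` with decaying multiplier columns the multiplier-vertex read of the sym multiplier
  table has ZERO plain and ZERO exit-face charge at every slot (p2's `hasSum_prod_vertexOfM` ∕ `hasSum_weighted_vertexOfM`).
HONEST: a statement about an1's sym multiplier letter ALONE; it removes the `Z_M` halves from the sym-table readings of (α)∕(γ) but proves NOTHING of (INV) ∕ (W-γ) ∕ (S) for
α+γ ∕ (S-τ) ∕ (Q-R) ∕ (LT) ∕ (Q-L) ∕ (C) ∕ «T2Shape» ∕ (hW, hWall); the COMB letter `M1At d Lc ρ cΛ j` (non-symmetrised `hessFFAt`) is NOT covered (no transverse reflection law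
for the single-order comb); NEVER «G-an2-4 closed» as (CONV-C); NOT D1, NOT `BetaPertH`, NOT continuum, NOT Clay.  2026-08-22; no existing file touched.
-/

noncomputable section

open Finset
open scoped BigOperators
open Literature.MathematicalPhysics.QuantumFieldTheory
open Literature.MathematicalPhysics.QuantumFieldTheory.Balaban1983to89
open Literature.MathematicalPhysics.QuantumFieldTheory.Balaban1983to89.Beta
open B12Sec2to5 (l1)
open ExpKernelCalculus (Site MKer VertexFamily)
open AffineAveraging (box toSite unitVec)
open AveragingContoursRooted (ctr ctrOff ctrOff_mem_box)
open OneStepResolventKernel (Fib)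
open SecondOrderResponse (colM vertexOfM)
open Summit.QuantumFields.BalabanUV.Beta.AxialDressingRooted (one_le_of_neZero)
open Summit.QuantumFields.BalabanUV.Beta.SymAveragingHessianCounts (symHessFFAt symHessKerAt symLinKerAt symHessFFAt_inl_inl symHessFFAt_inl_inr symHessFFAt_inr
  biLoc_symHessFFAt_of_near)
open Summit.QuantumFields.BalabanUV.Beta.SpineRooted (M1Of M1Of_apply vertexFamily_M1Of)
open Summit.QuantumFields.BalabanUV.Beta.LinearGaugeVH (nearBox mem_nearBox summable_of_finsupp)
open Summit.QuantumFields.BalabanUV.Beta.GAN24.SymLinKernelExpansion (tsum_coordWeight_mul_symLinKerAt_diag)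
open Summit.QuantumFields.BalabanUV.Beta.GAN24.SymLinKernelBlockMoments (tsum_coordWeight_mul_symLinKerAt_eq_zero)
open Summit.QuantumFields.BalabanUV.Beta.GAN24.SymRMChargeFree (tsum_symHessKerAt_row symHessKerAt_eq_zero_of_not_mem_left symHessKerAt_eq_zero_of_not_mem_right
  symLinKerAt_ctr_eq_zero_of_not_mem)
open Summit.QuantumFields.BalabanUV.Beta.GAN24.SymRMChargeFreeFace (tsum_prod_face_mul_symHessKerAt_weight_eq_zero)
open Summit.QuantumFields.BalabanUV.Beta.GAN24.WardResidualRotatedVertex (hasSum_prod_vertexOfM)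
open Summit.QuantumFields.BalabanUV.Beta.GAN24.WardResidualRotatedVertexWeighted (hasSum_weighted_vertexOfM)

namespace Summit.QuantumFields.BalabanUV.Beta.GAN24.SymM1ChargeFree

variable {Lc : ℕ} [NeZero Lc]

/-! ## §1 The plain pair charge of an1's symmetrised constraint Hessian vanishes (centred root, `Lc` odd) -/

/-- NOT IN PRINT; OUR BOOKKEEPING.  **THE PLAIN PAIR CHARGE OF an1's SYMMETRISED CONSTRAINT HESSIAN VANISHES IN EVERY CHANNEL** (centred root, `Lc` odd; every coarse bond
`(ρ′, w)`, every `(β, β′)`): `Σ'_{(x,x′)} h_sym,(ρ′,w)((β,x),(β′,x′)) = 0` — the `x′`-sum is a ROW sum (PART 2 §2), leaving `−½·Σ'_x W_{β′}(β,x)·q¹(β,x)`, zero by PART 1a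
(diagonal, exactness) ∕ PART 1b (off-diagonal, transverse block reflection). -/
theorem tsum_prod_symHessKerAt_eq_zero (hodd : Odd Lc) (ρ' : Fin (3 + 1)) (w : Fin (3 + 1) → ℤ) (β β' : Fin (3 + 1)) :
    ∑' xz : (Fin (3 + 1) → ℤ) × (Fin (3 + 1) → ℤ), symHessKerAt (ctr 4 Lc) Lc ρ' w (β, xz.1) (β', xz.2) = 0 := by
  classical
  set nb : Finset (Fin (3 + 1) → ℤ) := nearBox Lc w with hnb
  have hz : ∀ xz ∉ nb ×ˢ nb, symHessKerAt (ctr 4 Lc) Lc ρ' w (β, xz.1) (β', xz.2) = 0 := by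
    intro xz hxz
    rw [Finset.mem_product, not_and_or] at hxz
    rcases hxz with h1 | h2
    · exact symHessKerAt_eq_zero_of_not_mem_left ρ' w h1 β β' xz.2
    · exact symHessKerAt_eq_zero_of_not_mem_right ρ' w β xz.1 β' h2
  rw [tsum_eq_sum hz, Finset.sum_product]
  have hrow : ∀ x, ∑ x' ∈ nb, symHessKerAt (ctr 4 Lc) Lc ρ' w (β, x) (β', x')
      = -((((x β' : ℤ) : ℝ) + (((x + unitVec β) β' : ℤ) : ℝ) - ((((Lc : ℤ) • w + ctr 4 Lc) β' : ℤ) : ℝ)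
          - ((((Lc : ℤ) • w + ctr 4 Lc + (Lc : ℤ) • unitVec ρ') β' : ℤ) : ℝ)) * symLinKerAt (ctr 4 Lc) Lc ρ' w (β, x) / 2) := by
    intro x
    have e : ∑' x', symHessKerAt (ctr 4 Lc) Lc ρ' w (β, x) (β', x') = ∑ x' ∈ nb, symHessKerAt (ctr 4 Lc) Lc ρ' w (β, x) (β', x') :=
      tsum_eq_sum fun x' hx' => symHessKerAt_eq_zero_of_not_mem_right ρ' w β x β' hx'
    rw [← e]
    exact tsum_symHessKerAt_row ρ' w x β β'
  simp only [hrow]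
  -- back to a `tsum` over `x` (finite support of `q¹`) and PART 1a ∕ 1b
  set W : (Fin (3 + 1) → ℤ) → ℝ := fun x => ((x β' : ℤ) : ℝ) + (((x + unitVec β) β' : ℤ) : ℝ) - ((((Lc : ℤ) • w + ctr 4 Lc) β' : ℤ) : ℝ)
      - ((((Lc : ℤ) • w + ctr 4 Lc + (Lc : ℤ) • unitVec ρ') β' : ℤ) : ℝ) with hW
  have e2 : ∑ x ∈ nb, -(W x * symLinKerAt (ctr 4 Lc) Lc ρ' w (β, x) / 2) = -(1 / 2 : ℝ) * ∑' x, W x * symLinKerAt (ctr 4 Lc) Lc ρ' w (β, x) := by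
    rw [tsum_eq_sum (s := nb) (f := fun x => W x * symLinKerAt (ctr 4 Lc) Lc ρ' w (β, x)) (fun x hx => by
      show W x * symLinKerAt (ctr 4 Lc) Lc ρ' w (β, x) = 0
      rw [symLinKerAt_ctr_eq_zero_of_not_mem ρ' w hx β, mul_zero]), Finset.mul_sum]
    exact Finset.sum_congr rfl fun x _ => by ring
  rw [e2]
  have h0 : ∑' x, W x * symLinKerAt (ctr 4 Lc) Lc ρ' w (β, x) = 0 := by
    rcases eq_or_ne β β' with hββ | hββ
    · subst hββ
      exact tsum_coordWeight_mul_symLinKerAt_diag (one_le_of_neZero Lc) (ctrOff_mem_box (one_le_of_neZero Lc)) ρ' β w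
    · exact tsum_coordWeight_mul_symLinKerAt_eq_zero (d := 3) hodd ρ' w hββ
  rw [h0, mul_zero]

/-- NOT IN PRINT; OUR BOOKKEEPING.  **an1's SYM MULTIPLIER LETTER IS PLAIN-CHARGE-FREE PER LETTER, FIELD–FIELD CHANNELS** (centred root, `Lc` odd, every `cΛ j ρ′ w β β′`):
`Σ'_{(x,x′)} M1Of 3 Lc (symHessFFAt ρ_c Lc) cΛ j ρ′ w x x′ (inl β) (inl β′) = 0`. -/
theorem tsum_prod_symM1_inl_inl (hodd : Odd Lc) (cΛ : ℝ) (j : ℕ) (ρ' : Fin (3 + 1)) (w : Fin (3 + 1) → ℤ) (β β' : Fin (3 + 1)) :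
    ∑' xz : (Fin (3 + 1) → ℤ) × (Fin (3 + 1) → ℤ), M1Of 3 Lc (symHessFFAt (ctr 4 Lc) Lc) cΛ j ρ' w xz.1 xz.2 (Sum.inl β) (Sum.inl β') = 0 := by
  simp only [M1Of_apply, Pi.smul_apply, smul_eq_mul, symHessFFAt_inl_inl]
  rw [tsum_mul_left, tsum_prod_symHessKerAt_eq_zero hodd ρ' w β β', mul_zero]

/-- NOT IN PRINT; OUR BOOKKEEPING.  **… EVERY FIBRE INDEX** (the table lives on the field–field block). -/
theorem tsum_prod_symM1 (hodd : Odd Lc) (cΛ : ℝ) (j : ℕ) (ρ' : Fin (3 + 1)) (w : Fin (3 + 1) → ℤ) (a b : Fib 3) :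
    ∑' xz : (Fin (3 + 1) → ℤ) × (Fin (3 + 1) → ℤ), M1Of 3 Lc (symHessFFAt (ctr 4 Lc) Lc) cΛ j ρ' w xz.1 xz.2 a b = 0 := by
  rcases a with β | m <;> rcases b with β' | m'
  · exact tsum_prod_symM1_inl_inl hodd cΛ j ρ' w β β'
  · simp only [M1Of_apply, Pi.smul_apply, smul_eq_mul, symHessFFAt_inl_inr, mul_zero, tsum_zero]
  · simp only [M1Of_apply, Pi.smul_apply, smul_eq_mul, symHessFFAt_inr, mul_zero, tsum_zero]
  · simp only [M1Of_apply, Pi.smul_apply, smul_eq_mul, symHessFFAt_inr, mul_zero, tsum_zero]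

/-! ## §2 The exit-face pair charge of the sym multiplier letter vanishes, every `cΛ` -/

/-- NOT IN PRINT; OUR BOOKKEEPING.  **an1's SYM MULTIPLIER LETTER IS EXIT-FACE-CHARGE-FREE PER LETTER** (centred root, `Lc` odd; p2's face weight on the channel `(inl α, inl β)`):
`Σ'_{(x,x′)} 𝟙[x_α % Lc = Lc−1 ∧ x′_β % Lc = Lc−1] · M1Of 3 Lc (symHessFFAt ρ_c Lc) cΛ j ρ′ w x x′ (inl α) (inl β) = 0` — PART 3b §2 with `U ≡ cΛ·wM1 j`, `V ≡ 0`. -/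
theorem tsum_prod_face_symM1_inl_inl (hodd : Odd Lc) (cΛ : ℝ) (j : ℕ) (ρ' : Fin (3 + 1)) (w : Fin (3 + 1) → ℤ) (α β : Fin (3 + 1)) :
    ∑' xz : (Fin (3 + 1) → ℤ) × (Fin (3 + 1) → ℤ),
        (if xz.1 α % (Lc : ℤ) = (Lc : ℤ) - 1 ∧ xz.2 β % (Lc : ℤ) = (Lc : ℤ) - 1 then (1 : ℝ) else 0)
          * M1Of 3 Lc (symHessFFAt (ctr 4 Lc) Lc) cΛ j ρ' w xz.1 xz.2 (Sum.inl α) (Sum.inl β) = 0 := by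
  have h := tsum_prod_face_mul_symHessKerAt_weight_eq_zero hodd ρ' w α β (fun _ => cΛ * BalabanStepW2.wM1 3 Lc j) (fun _ => (0 : ℝ))
  refine Eq.trans (tsum_congr fun xz => ?_) h
  simp only [M1Of_apply, Pi.smul_apply, smul_eq_mul, symHessFFAt_inl_inl, add_zero]
  by_cases h1 : xz.1 α % (Lc : ℤ) = (Lc : ℤ) - 1
  · by_cases h2 : xz.2 β % (Lc : ℤ) = (Lc : ℤ) - 1
    · rw [if_pos ⟨h1, h2⟩, if_pos h1, if_pos h2]; ring
    · rw [if_neg (fun hh => h2 hh.2), if_pos h1, if_neg h2]; ring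
  · rw [if_neg (fun hh => h1 hh.1), if_neg h1]; ring

/-! ## §3 The multiplier-vertex read of the sym multiplier table carries no plain and no exit-face charge -/

/-- NOT IN PRINT; OUR BOOKKEEPING.  **EVERY MULTIPLIER-VERTEX READ OF an1's SYM MULTIPLIER TABLE HAS ZERO PLAIN CHARGE** (centred root, `Lc` odd): through ANY kernel `G` with
decaying multiplier columns, `HasSum (xz ↦ vertexOfM G Lc (M1Of 3 Lc (symHessFFAt ρ_c Lc) cΛ j) ν y′ xz.1 xz.2 a b) 0` — the `Z_M` half of p2's value forms DROPS for the sym tables. -/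
theorem hasSum_prod_vertexOfM_symM1 (hodd : Odd Lc) (cΛ : ℝ) {G : MKer (3 + 1) (Fib 3)} {C' m : ℝ} {c₀ : Site (3 + 1)} (ν : Fin (3 + 1))
    (y' : Site (3 + 1)) (hw : ∀ (ρ : Fin (3 + 1)) (w : Site (3 + 1)), |colM G Lc ν y' ρ w| ≤ C' * Real.exp (-m * l1 ((Lc : ℤ) • w - c₀))) (hm : 0 < m)
    (j : ℕ) (a b : Fib 3) :
    HasSum (fun xz : Site (3 + 1) × Site (3 + 1) => vertexOfM G Lc (M1Of 3 Lc (symHessFFAt (ctr 4 Lc) Lc) cΛ j) ν y' xz.1 xz.2 a b) 0 := by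
  have hLc : 1 ≤ Lc := one_le_of_neZero Lc
  have hH : VertexFamily (symHessFFAt (toSite (ctrOff (3 + 1) Lc)) Lc) Lc _ (1 / 2 : ℝ) := fun μ w =>
    biLoc_symHessFFAt_of_near hLc μ w (ctrOff_mem_box hLc) (c := (Lc : ℤ) • w) (fun i => by
      simp only [Pi.smul_apply, smul_eq_mul]; constructor <;> nlinarith [hLc]) (by norm_num : (0 : ℝ) ≤ 1 / 2)
  have hM := vertexFamily_M1Of (d := 3) hH cΛ j
  have h := hasSum_prod_vertexOfM (N := Lc) ν y' hw hm hM (by norm_num) a b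
  have hz : ∀ (ρ : Fin (3 + 1)) (w : Site (3 + 1)),
      ∑' xz : Site (3 + 1) × Site (3 + 1), M1Of 3 Lc (symHessFFAt (toSite (ctrOff (3 + 1) Lc)) Lc) cΛ j ρ w xz.1 xz.2 a b = 0 :=
    fun ρ w => tsum_prod_symM1 hodd cΛ j ρ w a b
  simp only [hz, mul_zero, tsum_zero, Finset.sum_const_zero] at h
  exact h

/-- NOT IN PRINT; OUR BOOKKEEPING.  **… AND ZERO EXIT-FACE CHARGE** (p2's face weight on `(inl α, inl β)`; `hasSum_weighted_vertexOfM`). -/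
theorem hasSum_face_vertexOfM_symM1 (hodd : Odd Lc) (cΛ : ℝ) {G : MKer (3 + 1) (Fib 3)} {C' m : ℝ} {c₀ : Site (3 + 1)} (ν : Fin (3 + 1))
    (y' : Site (3 + 1)) (hw : ∀ (ρ : Fin (3 + 1)) (w : Site (3 + 1)), |colM G Lc ν y' ρ w| ≤ C' * Real.exp (-m * l1 ((Lc : ℤ) • w - c₀))) (hm : 0 < m)
    (j : ℕ) (α β : Fin (3 + 1)) :
    HasSum (fun xz : Site (3 + 1) × Site (3 + 1) =>
      (if xz.1 α % (Lc : ℤ) = (Lc : ℤ) - 1 ∧ xz.2 β % (Lc : ℤ) = (Lc : ℤ) - 1 then (1 : ℝ) else 0)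
        * vertexOfM G Lc (M1Of 3 Lc (symHessFFAt (ctr 4 Lc) Lc) cΛ j) ν y' xz.1 xz.2 (Sum.inl α) (Sum.inl β)) 0 := by
  have hLc : 1 ≤ Lc := one_le_of_neZero Lc
  have hH : VertexFamily (symHessFFAt (toSite (ctrOff (3 + 1) Lc)) Lc) Lc _ (1 / 2 : ℝ) := fun μ w =>
    biLoc_symHessFFAt_of_near hLc μ w (ctrOff_mem_box hLc) (c := (Lc : ℤ) • w) (fun i => by
      simp only [Pi.smul_apply, smul_eq_mul]; constructor <;> nlinarith [hLc]) (by norm_num : (0 : ℝ) ≤ 1 / 2)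
  have hM := vertexFamily_M1Of (d := 3) hH cΛ j
  have hω : ∀ xz : Site (3 + 1) × Site (3 + 1),
      |(if xz.1 α % (Lc : ℤ) = (Lc : ℤ) - 1 ∧ xz.2 β % (Lc : ℤ) = (Lc : ℤ) - 1 then (1 : ℝ) else 0)| ≤ 1 := fun xz => by
    split_ifs <;> simp
  have h := (hasSum_weighted_vertexOfM (N := Lc) ν y' hw hm hM (by norm_num) (Sum.inl α) (Sum.inl β) hω).1
  have hz : ∀ (ρ : Fin (3 + 1)) (w : Site (3 + 1)),
      ∑' xz : Site (3 + 1) × Site (3 + 1), (if xz.1 α % (Lc : ℤ) = (Lc : ℤ) - 1 ∧ xz.2 β % (Lc : ℤ) = (Lc : ℤ) - 1 then (1 : ℝ) else 0)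
        * M1Of 3 Lc (symHessFFAt (toSite (ctrOff (3 + 1) Lc)) Lc) cΛ j ρ w xz.1 xz.2 (Sum.inl α) (Sum.inl β) = 0 :=
    fun ρ w => tsum_prod_face_symM1_inl_inl hodd cΛ j ρ w α β
  simp only [hz, mul_zero, tsum_zero, Finset.sum_const_zero] at h
  exact h

end Summit.QuantumFields.BalabanUV.Beta.GAN24.SymM1ChargeFree

end
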